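import Summits.ResolutionOfSingularities.ResolutionOfSingularities.Theorems.PurelyInseparableDim4ResConePowerConeTilt
import Summits.ResolutionOfSingularities.ResolutionOfSingularities.Theorems.PurelyInseparableDim4IsolatedHasseContact
import HarnessLib
import HarnessLib.Audit.Tags

/-!
# Purely inseparable four-folds — ALL HONEST LAYERS OF A PERSISTING POWER CONE ARE PURE
# (cell `res-dim4-pi`, K2(p) lane, slice B brick K15)

[OURS · counted 0 · cell `res-dim4-pi` · K2(p) lane holder res-dim4-p-12 g3's brick by signature (bus
2026-08-28 23:42Z), seat res-dim4-p-9 g3.]  Nothing here proves K2(p), `NoIsolatedTrap p p` or resolution of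
singularities in dimension ≥ 4 / characteristic `p`.

`…ResConePowerConeTilt` (p675934) read the layer `m = 1` of a persisting power cone `g′ = a′·L′^d`,
`L′ = λ·L̃ + ℓ′_j x_j`, against the birth layer `B₁` of `…ResConeLayerBirths`.  This file does the same for
EVERY honest layer `m` (`o + m < 2q`, below the cleaning threshold), replacing `∂_j` by the Hasse derivative
`D_j^{(m)}`:

* `coeff_add_single_eq_coeff_killVar_hasseDeriv` — the `m`-th `x_j`-row of `P` is `D_j^{(m)} P` at `x_j = 0`;
* `coeff_add_single_C_mul_linearForm_pow_layer` — layer `m` of `a·L^n` is `a·C(n,m)·ℓ_j^m · L̃^{n−m}`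
  (res-dim4-p-12's `IsolatedBand.hasseDeriv_single_linearForm_pow`);
* **`powerCone_layer_identity`** — `a′·C(d,m)·ℓ′_j^m·λ^{d−m}·coeff_μ(L̃^{d−m}) = c · coeff_{μ + 2m e_j}(shear j b G)`
  for `x_j`-free `μ` of degree `d − m` (`c = coeff_top (shear j b x^r)`), i.e. the birth layer `B_m` is the pure
  power `L̃^{d−m}` up to the scalar; **`births_eq_mul_pow_of_powerCone_step`** packages it as `∃ κ`.

bears_on: LADDER-RESOLUTION:D157-DOOR2 (res-dim4-pi · K2(p) · slice B · K15).  Supports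
stmt-ResolutionOfSingularities-16155 (helper).
-/

set_option linter.dupNamespace false -- mandated namespace of this single-conjunct summit

noncomputable section

namespace Summit.ResolutionOfSingularities.ResolutionOfSingularities.Theorems.PIDim4

namespace ResCone

open MvPolynomial Finset
open Literature.AlgebraicGeometry.Resolution
open Literature.AlgebraicGeometry.Resolution.CentreBlowup
open Literature.AlgebraicGeometry.Resolution.Hauser2010
open Literature.AlgebraicGeometry.Resolution.HauserPerlega2019

variable {K : Type} [Field K]

/-! ## 1. Layer `m` through the Hasse derivative `D_j^{(m)}` -/

/-- **The `m`-th `x_j`-row is `D_j^{(m)}` at `x_j = 0`**: for `μ_j = 0`,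
`coeff_{μ + m e_j} P = coeff_μ ((D_j^{(m)} P)|_{x_j = 0})`. [folklore] -/
theorem coeff_add_single_eq_coeff_killVar_hasseDeriv [DecidableEq K] (j : Fin 4) (m : ℕ)
    (P : MvPolynomial (Fin 4) K) {μ : Fin 4 →₀ ℕ} (hμ : μ j = 0) :
    coeff (μ + Finsupp.single j m) P =
      coeff μ (PointBlowup.killVar j (hasseDeriv (Finsupp.single j m) P)) := by
  rw [coeff_killVar, if_pos hμ, IsolatedBand.coeff_hasseDeriv_single', hμ, zero_add, Nat.choose_self,
    Nat.cast_one, one_mul]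

/-- **Layer `m` of `a · L^n`**: for `L = Σ ℓᵢ xᵢ`, `L̃ = L − ℓ_j x_j` and `μ_j = 0`,
`coeff_{μ + m e_j} (a · L^n) = a · C(n, m) · ℓ_j^m · coeff_μ (L̃^{n−m})`. [folklore] -/
theorem coeff_add_single_C_mul_linearForm_pow_layer [DecidableEq K] (j : Fin 4) (ℓ : Fin 4 → K) (a : K)
    (n m : ℕ) {μ : Fin 4 →₀ ℕ} (hμ : μ j = 0) :
    coeff (μ + Finsupp.single j m) (C a * (∑ i, C (ℓ i) * X i) ^ n) =
      a * (n.choose m) * ℓ j ^ m * coeff μ ((∑ i, C (Function.update ℓ j 0 i) * X i) ^ (n - m)) := by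
  rw [coeff_C_mul, coeff_add_single_eq_coeff_killVar_hasseDeriv j m _ hμ,
    IsolatedBand.hasseDeriv_single_linearForm_pow j ℓ n m, map_mul, map_pow, killVar_linearForm]
  have hC : PointBlowup.killVar j (C (((n.choose m : ℕ) : K) * ℓ j ^ m)) = C (((n.choose m : ℕ) : K) * ℓ j ^ m) := by
    rw [← MvPolynomial.algebraMap_eq]; exact (PointBlowup.killVar j).commutes _
  rw [hC, coeff_C_mul]
  ring

/-! ## 2. The layer identity of a persisting power cone -/

section Step

variable [DecidableEq K]

/-- **THE LAYER IDENTITY** (slice B, every honest layer `m`, `o + m < 2q`): at a shade-keeping band step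
`s →(j,b) s′` (`x^r ∣ F`, `q < ord₀ F = o`, `b_j = 0`) whose NEW residual cone is a power cone `g′ = a′ · L′^d`
with `L′ = λ·L̃ + ℓ′_j x_j` off the chart letter, for every `x_j`-free `μ` of degree `d − m`:
`a′ · C(d,m) · ℓ′_j^m · λ^{d−m} · coeff_μ (L̃^{d−m}) = c · coeff_{μ + 2m e_j} (shear j b G)` — the birth layer
`B_m` of `…ResConeLayerBirths` is the pure power `L̃^{d−m}` up to a scalar (`m = 1`: `powerCone_tilt_identity`).
[OURS] [cite: CossartJannsenSaito2020, Thm. 3.10(4), Thm. 9.3] -/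
theorem powerCone_layer_identity {q : ℕ} (j : Fin 4) {b : Fin 4 → K} (hbj : b j = 0) {s : State K} {o : ℕ}
    (ho : ordZero s.F = o) (hr : ∀ d ∈ s.F.support, s.r ≤ d) (hqo : q < o) {m : ℕ} (hm : o + m < 2 * q)
    (heq : (CentreBlowup.step q Finset.univ j b s).shade = s.shade) {ℓ ℓ' : Fin 4 → K} {a' lam : K}
    (hg' : resForm (CentreBlowup.step q Finset.univ j b s) =
      C a' * (∑ i, C (ℓ' i) * X i) ^ (o - s.r.degree))
    (hlam : ∀ i, i ≠ j → ℓ' i = lam * ℓ i) {μ : Fin 4 →₀ ℕ} (hμj : μ j = 0)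
    (hμ : μ.degree + m = o - s.r.degree) :
    a' * ↑((o - s.r.degree).choose m) * ℓ' j ^ m * lam ^ (o - s.r.degree - m) *
        coeff μ ((∑ i, C (Function.update ℓ j 0 i) * X i) ^ (o - s.r.degree - m)) =
      coeff (topMonomial j b s.r) (shear j b (monomial s.r (1 : K))) *
        coeff (μ + Finsupp.single j (2 * m)) (shear j b (s.F.divMonomial s.r)) := by
  -- layer `m` of `g′` read on the power-cone presentation …
  have h1 : coeff (μ + Finsupp.single j m) (resForm (CentreBlowup.step q Finset.univ j b s)) =
      a' * ↑((o - s.r.degree).choose m) * ℓ' j ^ m *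
        coeff μ ((∑ i, C (Function.update ℓ' j 0 i) * X i) ^ (o - s.r.degree - m)) := by
    rw [hg', coeff_add_single_C_mul_linearForm_pow_layer j ℓ' a' _ m hμj]
  rw [linearForm_update_eq_C_mul j hlam, mul_pow, ← C_pow, coeff_C_mul] at h1
  -- … and on the births
  have h2 := coeff_resForm_step_eq_mul_coeff_shear_divMonomial_of_add_lt j hbj ho hr hqo heq
    (μ := μ + Finsupp.single j m) (by rw [map_add, Finsupp.degree_single]; exact hμ)
    (by rw [Finsupp.add_apply, hμj, Finsupp.single_eq_same]; omega)
  rw [Finsupp.add_apply, hμj, Finsupp.single_eq_same, zero_add, add_assoc, ← Finsupp.single_add, ← two_mul,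
    h1] at h2
  rw [← h2]
  ring

/-- **ALL HONEST BIRTH LAYERS ARE PURE POWERS** (a necessary condition for the power cone to persist): in the
situation of `powerCone_layer_identity`, `∃ κ, coeff_{μ + 2m e_j} (shear j b G) = κ · coeff_μ (L̃^{d−m})` for all
`x_j`-free `μ` of degree `d − m` — the birth layer `B_m` is proportional to `L̃^{d−m}` coefficientwise.
[OURS] [cite: CossartJannsenSaito2020, Thm. 3.10(4), Thm. 9.3] -/
theorem births_eq_mul_pow_of_powerCone_step {q : ℕ} (j : Fin 4) {b : Fin 4 → K} (hbj : b j = 0)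
    {s : State K} {o : ℕ} (ho : ordZero s.F = o) (hr : ∀ d ∈ s.F.support, s.r ≤ d) (hqo : q < o)
    {m : ℕ} (hm : o + m < 2 * q) (heq : (CentreBlowup.step q Finset.univ j b s).shade = s.shade)
    {ℓ ℓ' : Fin 4 → K} {a' lam : K}
    (hg' : resForm (CentreBlowup.step q Finset.univ j b s) =
      C a' * (∑ i, C (ℓ' i) * X i) ^ (o - s.r.degree))
    (hlam : ∀ i, i ≠ j → ℓ' i = lam * ℓ i) :
    ∃ κ : K, ∀ μ : Fin 4 →₀ ℕ, μ j = 0 → μ.degree + m = o - s.r.degree →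
      coeff (μ + Finsupp.single j (2 * m)) (shear j b (s.F.divMonomial s.r)) =
        κ * coeff μ ((∑ i, C (Function.update ℓ j 0 i) * X i) ^ (o - s.r.degree - m)) := by
  have hc := coeff_topMonomial_ne_zero j hbj s.r
  refine ⟨a' * ↑((o - s.r.degree).choose m) * ℓ' j ^ m * lam ^ (o - s.r.degree - m) /
    coeff (topMonomial j b s.r) (shear j b (monomial s.r (1 : K))), fun μ hμj hμ => ?_⟩
  have h := powerCone_layer_identity j hbj ho hr hqo hm heq hg' hlam hμj hμ
  rw [div_mul_eq_mul_div, eq_div_iff hc, h, mul_comm]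

end Step

end ResCone

end Summit.ResolutionOfSingularities.ResolutionOfSingularities.Theorems.PIDim4
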